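import Summits.QuantumFields.BalabanUV.Beta.GAN24.ChargeTowerExplicitPotential

/-!
# `BalabanUV.Beta.GAN24.WardGammaExitExplicitPotential` — binder row G-an2-4 ∕ (CONV-C), the (S) row «(S) := (INV-X-geo) ∘ (W-γ)» (RULING R-gan24p1-g27-1 B (viii), R-g28-1 (i)),
# EXIT⊗EXIT class, LEVELS `j + 1 ≥ 1`: **(W-γ)_{j+1} MODULO THE SOURCE PAIRING OF ONE EXPLICIT 1-FORM.  The displayed hypothesis `hP` of `ExitChargeSourcePairing` §6 — a closed
# form of the `n_m ⊗ gaugeWt` pairing for EVERY potential `m` representing the charge — need only hold for the charge tower's EXPLICIT potential `m⋆_c = c·Π^ρ m̃^{Lc}_{αβ}`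
# (`ChargeTowerExplicitPotential.exists_explicit_potential_exitCharge`); §5 of that file with its `∃ m` opened up**
# (G-an2-4 CRUX TEAM (2), seat `b2b-balaban-gan24-p2` = road-P2 chair, gen 43, INTENT 4 v2 part 1)

NOT IN PRINT; OUR BOOKKEEPING ([folklore] BY NAME over this seat's `ExitChargeSourcePairing.E2imageRead_comp_eq_sourceRead_succ`, `RotatedVertexEndExitValue.wardGamma_exit_of_gammaRead`,
`ChargeTowerExplicitPotential.exists_explicit_potential_exitCharge ∕ abs_edgePotentialIte_le_one`, leaf-06 g46 `EdgePlaquettePotential.edgePotential_apply ∕ edgePotential_add_zsmul`,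
leaf-06 g45∕g47 `GaugeReadLabelSums.abs_read_le`, `GaugeReadChargeComb.exists_vertexFamily_combResponse`, `EdgePotentialColumnOrthogonal.abs_axProjAt_le`, road-P2 g42
`ChargeTowerRegauge.axProjAt_add_zsmul_of_periodic_mul`, `ChargeTowerClimb.abs_tsum_sum_wΦ_mul_le`; 0 `def`, 0 cited fact, 0 `def … : Prop`, 0 sorry).
HONEST FRAMING (cell contract, verbatim): «discharging `BetaPertH` makes Bałaban's UV stability UNCONDITIONAL — a real constructive-QFT result; it is NOT the continuum limit and NOT
the Clay problem.»  HONEST DEPENDENCY (verbatim): «continuum YM on T⁴ ⇐ BetaPertH ∧ nine spine estimates (0/9 proved); BetaPertH ⇐ (D1) ∧ (D4) ∧ CAP+tail; G-an2-4 gates asym,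
D1 and NE2/3/4.»

THE OBJECTS.  In-block root `ρ = toSite r`, `r ∈ box (d+1) Lc`; `G_k = coDressKBmAt ρ Lc (KInvStep Lc k)`, `S_k = SpureRecAt … k`, `M_k = M1At … k`, `𝒟_k(ν,y′) = dM G_k Lc S_k M_k ν y′`;
the exit⊗exit charge `C_{j+1}(κ,u) = Σ'_{(x,z)} 𝟙^{exit}_α(x)𝟙^{exit}_β(z)·S_{j+1} κ u x z (inl α)(inl β)` (`α ≠ β`); the edge potential in closed form
`m̃ l x = [l = α]·Lc⁻²·(x_β % Lc) − [l = β]·Lc⁻¹·𝟙^{exit}_β(x)·(x_α % Lc)`; THE EXPLICIT POTENTIAL `m⋆_c := c·Π^ρ m̃` (`∃ c, C_{j+1} = wVH_{j+1}·Δ_{j+1} m⋆_c` — `ChargeTowerExplicitPotential`);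
the SOURCE FORM `n_m κ u = Π^ρ m κ u − (Lc^{d+1})⁻¹·𝒬_{Lc} m κ 0·𝟙^{exit}_κ(u)`; the END-POINT profile `V⁺_{j+1}` of `RotatedVertexEndExitValue` §4.
* §1 `edgePotentialIte_add_zsmul`, **`explicitPotential_abs_le`**, **`explicitPotential_add_zsmul`** — `m⋆_c` is bounded (`|m⋆_c| ≤ |c|(1 + 2(d+1)Lc)`) and `Lc`-periodic
  (it is comb-free by construction: `axProjAt_eq_zero_of_isCombBond`).
* §2 **`gaugeCharge_exit_eq_sourcePairing_of`** — `ExitChargeSourcePairing` §5 FOR A GIVEN POTENTIAL: any bounded `Lc`-periodic `m` with `C_{j+1} = wVH_{j+1}·Δ_{j+1} m` has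
  `Σ_κ Σ'_u ⟨G_{j+1}∘𝒟_{j+1}(e), gaugeWt⟩(κ,u)·C_{j+1}(κ,u) = Σ'_x Σ_κ₂ gaugeWt Lc y κ₂ x·(Σ'_u Σ_κ n_m κ u·𝒟_{j+1}(e) u x (inl κ)(inl κ₂))` (the same proof, the existential opened).
* §3 **`wardGamma_exit_of_explicitSourcePairing`** — (W-γ)_{j+1} FOR THE EXIT⊗EXIT CLASS MODULO THE PAIRING OF `n⋆ := n_{m⋆}` ALONE (in-block root, `α ≠ β`, all `cE cVH cΛ`, every
  `j`, slot, label, constant `c′`): IF for every `c` with the charge identity the `n⋆ ⊗ gaugeWt` pairing of `𝒟_{j+1}(e)` is `c′·Σ'_u Σ_κ 𝟙[blk(u+e_κ) = y]·colH G_{j+1}(e) κ u·C_{j+1}(κ,u)`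
  THEN the (γ) exit⊗exit charge of the slot is `(−4c′)·V⁺_{j+1}` — `ExitChargeSourcePairing.wardGamma_exit_of_sourcePairing` with the quantifier over ALL representing potentials
  replaced by the ONE explicit family.  Consumed by `SlotMomentExitPairOfSourcePairing` (the (S) row at level `j+1`, with leaf-02 g59 ∕ leaf-06 g48).
Asserts NO value of any resolvent column and NO closed form of the pairing; (W-γ) at levels `≥ 1` ∕ (S) ∕ (INV) ∕ (Π) NOT claimed; NOTHING of (Q-R) ∕ (DL) ∕ (LT) ∕ «T2Shape» ∕
(hW, hWall) discharged; NEVER «G-an2-4 closed» as (CONV-C); NOT D1, NOT `BetaPertH`, NOT continuum, NOT Clay.  2026-08-23; no existing file touched.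
-/

noncomputable section

open Finset
open scoped BigOperators
open Literature.MathematicalPhysics.QuantumFieldTheory
open Literature.MathematicalPhysics.QuantumFieldTheory.Balaban1983to89
open Literature.MathematicalPhysics.QuantumFieldTheory.Balaban1983to89.Beta
open B12Sec2to5 (l1 l1_nonneg)
open ExpKernelCalculus (Site MKer Decays BiLoc VertexFamily Zl comp summable_exp_shift')
open AffineAveraging (Form0 Form1 box toSite unitVec dz contourSum)
open AveragingContours (blk)
open RootedComb (axProjAt)
open KernelSpecInstance (wΦ)
open OneStepResolventKernel (Fib LocStencil)
open OneStepKernelFamily (KInvStep colH)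
open SecondOrderResponse (colM dM vertexFamily_dM)
open BalabanStepJets (locStencil_mono)
open BalabanStepJetsSucc (wVH)
open Summit.QuantumFields.BalabanUV.Beta.TameKernelCalculus (Spr)
open Summit.QuantumFields.BalabanUV.Beta.AxialDressingRooted (IsCombBondAt coDressKBmAt decays_coDressKBmAt_KInvStep one_le_of_neZero)
open Summit.QuantumFields.BalabanUV.Beta.SpineRooted (SpureRecAt M1At locStencil_SpureRecAt vertexFamily_M1At)
open Summit.QuantumFields.BalabanUV.Beta.KernelWardRelative (gaugeWt)
open Summit.QuantumFields.BalabanUV.Beta.KernelWardResponse (decays_of_biLoc)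
open Summit.QuantumFields.BalabanUV.Beta.KernelWardResidual (abs_gaugeWt_le_one)
open Summit.QuantumFields.BalabanUV.Beta.GAN24.GaugeReadLabelSums (abs_read_le)
open Summit.QuantumFields.BalabanUV.Beta.GAN24.GaugeReadChargeComb (exists_vertexFamily_combResponse)
open Summit.QuantumFields.BalabanUV.Beta.GAN24.CombSlotDerivativeBorderRead (gaugeWt_eq_dz)
open Summit.QuantumFields.BalabanUV.Beta.GAN24.ChargeTowerClimb (abs_tsum_sum_wΦ_mul_le)
open Summit.QuantumFields.BalabanUV.Beta.GAN24.ChargeTowerRegauge (axProjAt_add_zsmul_of_periodic_mul)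
open Summit.QuantumFields.BalabanUV.Beta.GAN24.EdgePlaquettePotential (edgePotential_apply edgePotential_add_zsmul)
open Summit.QuantumFields.BalabanUV.Beta.GAN24.EdgePotentialColumnOrthogonal (abs_axProjAt_le)
open Summit.QuantumFields.BalabanUV.Beta.GAN24.ExitChargeSourcePairing (E2imageRead_comp_eq_sourceRead_succ)
open Summit.QuantumFields.BalabanUV.Beta.GAN24.RotatedVertexEndExitValue (wardGamma_exit_of_gammaRead)
open Summit.QuantumFields.BalabanUV.Beta.GAN24.ChargeTowerExplicitPotential (abs_edgePotentialIte_le_one exists_explicit_potential_exitCharge)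

namespace Summit.QuantumFields.BalabanUV.Beta.GAN24.WardGammaExitExplicitPotential

variable {d : ℕ} {Lc : ℕ} [NeZero Lc] {r : Fin (d + 1) → ℕ}

/-! ## §1 The explicit potential is bounded and periodic -/
omit [NeZero Lc] in
/-- [folklore] The edge potential in closed (`ite`) form is `Lc`-periodic in every direction (leaf-06 g46 `edgePotential_add_zsmul` ⨾ `edgePotential_apply`). -/
theorem edgePotentialIte_add_zsmul (hLc : 1 ≤ Lc) {α β : Fin (d + 1)} (hαβ : α ≠ β) (κ : Fin (d + 1)) (x v : Site (d + 1)) :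
    ((if κ = α then ((Lc : ℝ) ^ 2)⁻¹ * ((((x + (Lc : ℤ) • v) β % (Lc : ℤ) : ℤ)) : ℝ) else 0)
        - (if κ = β then (Lc : ℝ)⁻¹ * (if (x + (Lc : ℤ) • v) β % (Lc : ℤ) = (Lc : ℤ) - 1 then (1 : ℝ) else 0) * ((((x + (Lc : ℤ) • v) α % (Lc : ℤ) : ℤ)) : ℝ) else 0))
      = ((if κ = α then ((Lc : ℝ) ^ 2)⁻¹ * (((x β % (Lc : ℤ) : ℤ)) : ℝ) else 0)
        - (if κ = β then (Lc : ℝ)⁻¹ * (if x β % (Lc : ℤ) = (Lc : ℤ) - 1 then (1 : ℝ) else 0) * (((x α % (Lc : ℤ) : ℤ)) : ℝ) else 0)) := by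
  have h := edgePotential_add_zsmul hLc hαβ κ x v
  rwa [edgePotential_apply hLc hαβ, edgePotential_apply hLc hαβ] at h

/-- NOT IN PRINT; OUR BOOKKEEPING.  **THE EXPLICIT POTENTIAL `m⋆_c = c·Π^ρ m̃` IS BOUNDED**: `|m⋆_c κ u| ≤ |c|·(1 + 2(d+1)Lc)` (`abs_axProjAt_le` ⨾ `abs_edgePotentialIte_le_one`). -/
theorem explicitPotential_abs_le (hr : r ∈ box (d + 1) Lc) {α β : Fin (d + 1)} (hαβ : α ≠ β) (c : ℝ) (κ : Fin (d + 1)) (u : Site (d + 1)) :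
    |c * axProjAt (toSite r) Lc (fun l x => (if l = α then ((Lc : ℝ) ^ 2)⁻¹ * (((x β % (Lc : ℤ) : ℤ)) : ℝ) else 0)
              - (if l = β then (Lc : ℝ)⁻¹ * (if x β % (Lc : ℤ) = (Lc : ℤ) - 1 then (1 : ℝ) else 0) * (((x α % (Lc : ℤ) : ℤ)) : ℝ) else 0)) κ u|
      ≤ |c| * (1 + 2 * ((((d + 1 : ℕ) : ℝ)) * Lc * 1)) := by
  have hLc : 1 ≤ Lc := one_le_of_neZero Lc
  rw [abs_mul]
  exact mul_le_mul_of_nonneg_left (abs_axProjAt_le hLc hr (fun l x => abs_edgePotentialIte_le_one hLc hαβ l x) κ u) (abs_nonneg c)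

/-- NOT IN PRINT; OUR BOOKKEEPING.  **THE EXPLICIT POTENTIAL IS `Lc`-PERIODIC**: `m⋆_c κ (x + Lc•v) = m⋆_c κ x` (§1a ⨾ `axProjAt_add_zsmul_of_periodic_mul`). -/
theorem explicitPotential_add_zsmul {α β : Fin (d + 1)} (hαβ : α ≠ β) (c : ℝ) (κ : Fin (d + 1)) (x v : Site (d + 1)) :
    c * axProjAt (toSite r) Lc (fun l x => (if l = α then ((Lc : ℝ) ^ 2)⁻¹ * (((x β % (Lc : ℤ) : ℤ)) : ℝ) else 0)
              - (if l = β then (Lc : ℝ)⁻¹ * (if x β % (Lc : ℤ) = (Lc : ℤ) - 1 then (1 : ℝ) else 0) * (((x α % (Lc : ℤ) : ℤ)) : ℝ) else 0)) κ (x + (Lc : ℤ) • v)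
      = c * axProjAt (toSite r) Lc (fun l x => (if l = α then ((Lc : ℝ) ^ 2)⁻¹ * (((x β % (Lc : ℤ) : ℤ)) : ℝ) else 0)
              - (if l = β then (Lc : ℝ)⁻¹ * (if x β % (Lc : ℤ) = (Lc : ℤ) - 1 then (1 : ℝ) else 0) * (((x α % (Lc : ℤ) : ℤ)) : ℝ) else 0)) κ x := by
  have hLc : 1 ≤ Lc := one_le_of_neZero Lc
  have hper : ∀ (κ : Fin (d + 1)) (x v : Site (d + 1)),
      (fun l x => (if l = α then ((Lc : ℝ) ^ 2)⁻¹ * (((x β % (Lc : ℤ) : ℤ)) : ℝ) else 0)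
              - (if l = β then (Lc : ℝ)⁻¹ * (if x β % (Lc : ℤ) = (Lc : ℤ) - 1 then (1 : ℝ) else 0) * (((x α % (Lc : ℤ) : ℤ)) : ℝ) else 0)) κ (x + ((Lc * 1 : ℕ) : ℤ) • v)
        = (fun l x => (if l = α then ((Lc : ℝ) ^ 2)⁻¹ * (((x β % (Lc : ℤ) : ℤ)) : ℝ) else 0)
              - (if l = β then (Lc : ℝ)⁻¹ * (if x β % (Lc : ℤ) = (Lc : ℤ) - 1 then (1 : ℝ) else 0) * (((x α % (Lc : ℤ) : ℤ)) : ℝ) else 0))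
          κ x := fun κ x v => by
    simp only [Nat.mul_one]
    exact edgePotentialIte_add_zsmul hLc hαβ κ x v
  have h := axProjAt_add_zsmul_of_periodic_mul (Lc := Lc) 1 (toSite r)
    (m := (fun l x => (if l = α then ((Lc : ℝ) ^ 2)⁻¹ * (((x β % (Lc : ℤ) : ℤ)) : ℝ) else 0) - (if l = β then (Lc : ℝ)⁻¹ * (if x β % (Lc : ℤ) = (Lc : ℤ) - 1 then (1 : ℝ) else 0) * (((x α % (Lc : ℤ) : ℤ)) : ℝ) else 0))) hper κ x v
  simp only [Nat.mul_one] at h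
  rw [h]

/-! ## §2 `ExitChargeSourcePairing` §5 for a given potential -/

/-- NOT IN PRINT; OUR BOOKKEEPING.  **THE (γ) exit⊗exit CHARGE IS THE `n_m ⊗ gaugeWt` SOURCE PAIRING — FOR ANY GIVEN POTENTIAL** (in-block root, all `cE cVH cΛ`, every `j`, slot `(ν,y′)`,
label `y`): if `m` is bounded, `Lc`-periodic and represents the charge (`C_{j+1} = wVH_{j+1}·Δ_{j+1} m`), then
`Σ_κ Σ'_u ⟨G_{j+1}∘𝒟_{j+1}(e), gaugeWt⟩(κ,u)·C_{j+1}(κ,u) = Σ'_x Σ_κ₂ gaugeWt Lc y κ₂ x·(Σ'_u Σ_κ n_m κ u·𝒟_{j+1}(e) u x (inl κ)(inl κ₂))` — `ExitChargeSourcePairing` §5 with its `∃ m` opened. -/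
theorem gaugeCharge_exit_eq_sourcePairing_of (hr : r ∈ box (d + 1) Lc) (cE cVH cΛ : ℝ) {α β : Fin (d + 1)} (j : ℕ)
    {m : Form1 (d + 1) ℝ} {B : ℝ} (hmB : ∀ κ u, |m κ u| ≤ B) (hper : ∀ κ x v, m κ (x + (Lc : ℤ) • v) = m κ x)
    (hT : (∀ (ν : Fin (d + 1)) (y' : Site (d + 1)), ∑' xz : Site (d + 1) × Site (d + 1),
        (if xz.1 α % (Lc : ℤ) = (Lc : ℤ) - 1 then (1 : ℝ) else 0) * (if xz.2 β % (Lc : ℤ) = (Lc : ℤ) - 1 then (1 : ℝ) else 0)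
          * SpureRecAt d Lc (toSite r) cE cVH cΛ (j + 1) ν y' xz.1 xz.2 (Sum.inl α) (Sum.inl β)
        = wVH d Lc (j + 1) * ∑' v, ∑ l : Fin (d + 1), wΦ (N := Lc ^ (j + 1)) ν l (y' - v) * m l v))
    (ν : Fin (d + 1)) (y' y : Site (d + 1)) :
    (∑ κ : Fin (d + 1), ∑' u : Site (d + 1),
        (∑' x, ∑ κ₂, comp (coDressKBmAt (toSite r) Lc (KInvStep (d := d) Lc (j + 1)))
            (dM (coDressKBmAt (toSite r) Lc (KInvStep (d := d) Lc (j + 1))) Lc (SpureRecAt d Lc (toSite r) cE cVH cΛ (j + 1)) (M1At d Lc (toSite r) cΛ (j + 1)) ν y')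
            u x (Sum.inl κ) (Sum.inl κ₂) * gaugeWt Lc y κ₂ x)
          * ∑' xz : Site (d + 1) × Site (d + 1), ((if xz.1 α % (Lc : ℤ) = (Lc : ℤ) - 1 then (1 : ℝ) else 0) * (if xz.2 β % (Lc : ℤ) = (Lc : ℤ) - 1 then (1 : ℝ) else 0))
            * SpureRecAt d Lc (toSite r) cE cVH cΛ (j + 1) κ u xz.1 xz.2 (Sum.inl α) (Sum.inl β))
      = ∑' x, ∑ κ₂, gaugeWt Lc y κ₂ x * (∑' u, ∑ κ,
          (axProjAt (toSite r) Lc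
                  m κ u
                - ((Lc : ℝ) ^ (d + 1))⁻¹ * (contourSum Lc
                  m κ 0
                  * (if u κ % (Lc : ℤ) = (Lc : ℤ) - 1 then (1 : ℝ) else 0)))
            * dM (coDressKBmAt (toSite r) Lc (KInvStep (d := d) Lc (j + 1))) Lc (SpureRecAt d Lc (toSite r) cE cVH cΛ (j + 1)) (M1At d Lc (toSite r) cΛ (j + 1)) ν y'
                u x (Sum.inl κ) (Sum.inl κ₂)) := by
  classical
  have hLc : 1 ≤ Lc := one_le_of_neZero Lc
  simp only [hT]
  set G := coDressKBmAt (toSite r) Lc (KInvStep (d := d) Lc (j + 1)) with hGdef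
  obtain ⟨δG, CG, hδG, hCG, hG⟩ := decays_coDressKBmAt_KInvStep (d := d) hr (j + 1)
  obtain ⟨Cs, δs, hδs, hS⟩ := locStencil_SpureRecAt (d := d) (Lc := Lc) hLc hr cE cVH cΛ (j + 1)
  have hCs : 0 ≤ Cs := (hS 0 0).nonneg (Sum.inl 0)
  have hδ : 0 < min δs δG := lt_min hδs hδG
  have hSδ : LocStencil (SpureRecAt d Lc (toSite r) cE cVH cΛ (j + 1)) Cs (min δs δG) := locStencil_mono hS hCs (min_le_left _ _)
  have hMδ := vertexFamily_M1At (d := d) (Lc := Lc) hLc hr cΛ (j + 1) hδ.le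
  have hW := vertexFamily_dM (N := Lc) hG hCG hSδ hMδ hδ (min_le_right _ _) ν y'
  have hδ2 : 0 < min δs δG / 2 := by positivity
  have hWs : Spr (dM G Lc (SpureRecAt d Lc (toSite r) cE cVH cΛ (j + 1)) (M1At d Lc (toSite r) cΛ (j + 1)) ν y') :=
    ⟨_, _, hδ2, decays_of_biLoc hW hδ2.le⟩
  have hB0 : 0 ≤ B := (abs_nonneg _).trans (hmB 0 0)
  have hEb : ∀ κ u, |wVH d Lc (j + 1) * ∑' v, ∑ l : Fin (d + 1), wΦ (N := Lc ^ (j + 1)) κ l (u - v) * m l v|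
      ≤ |wVH d Lc (j + 1)| * (B * ∑ κ : Fin (d + 1), ∑ l : Fin (d + 1), ∑' z : Site (d + 1), |wΦ (N := Lc ^ (j + 1)) κ l z|) := by
    intro κ u
    rw [abs_mul]
    refine mul_le_mul_of_nonneg_left ((abs_tsum_sum_wΦ_mul_le (Lc ^ (j + 1)) hmB κ u).trans (mul_le_mul_of_nonneg_left ?_ hB0)) (abs_nonneg _)
    exact Finset.single_le_sum (f := fun κ => ∑ l : Fin (d + 1), ∑' z : Site (d + 1), |wΦ (N := Lc ^ (j + 1)) κ l z|)
      (fun κ _ => Finset.sum_nonneg fun l _ => tsum_nonneg fun z => abs_nonneg _) (Finset.mem_univ κ)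
  obtain ⟨CA, Cs', CM, δA, hδA, hAf, -, -⟩ := exists_vertexFamily_combResponse (d := d) (Lc := Lc) hLc hr cE cVH cΛ (j + 1)
  have hw : ∀ κ u, |∑' x, ∑ κ₂, comp G (dM G Lc (SpureRecAt d Lc (toSite r) cE cVH cΛ (j + 1)) (M1At d Lc (toSite r) cΛ (j + 1)) ν y') u x (Sum.inl κ) (Sum.inl κ₂)
      * gaugeWt Lc y κ₂ x| ≤ ((d + 1 : ℕ) * CA * Zl (d + 1) δA) * Real.exp (-δA * l1 (u - (Lc : ℤ) • y')) :=
    fun κ u => abs_read_le (hAf ν y') hδA (fun κ₂ x => abs_gaugeWt_le_one Lc y κ₂ x) u (Sum.inl κ)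
  have hsw : ∀ κ, Summable fun u => (∑' x, ∑ κ₂, comp G (dM G Lc (SpureRecAt d Lc (toSite r) cE cVH cΛ (j + 1)) (M1At d Lc (toSite r) cΛ (j + 1)) ν y') u x (Sum.inl κ) (Sum.inl κ₂)
      * gaugeWt Lc y κ₂ x) * (wVH d Lc (j + 1) * ∑' v, ∑ l : Fin (d + 1), wΦ (N := Lc ^ (j + 1)) κ l (u - v) * m l v) := by
    intro κ
    refine Summable.of_norm_bounded ((((summable_exp_shift' hδA ((Lc : ℤ) • y')).mul_left ((d + 1 : ℕ) * CA * Zl (d + 1) δA)).mul_right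
      (|wVH d Lc (j + 1)| * (B * ∑ κ : Fin (d + 1), ∑ l : Fin (d + 1), ∑' z : Site (d + 1), |wΦ (N := Lc ^ (j + 1)) κ l z|)))) (fun u => ?_)
    rw [Real.norm_eq_abs, abs_mul]
    exact mul_le_mul (hw κ u) (hEb κ u) (abs_nonneg _) ((abs_nonneg _).trans (hw κ u))
  have hL : (∑ κ : Fin (d + 1), ∑' u : Site (d + 1),
        (∑' x, ∑ κ₂, comp G (dM G Lc (SpureRecAt d Lc (toSite r) cE cVH cΛ (j + 1)) (M1At d Lc (toSite r) cΛ (j + 1)) ν y') u x (Sum.inl κ) (Sum.inl κ₂) * gaugeWt Lc y κ₂ x)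
          * (wVH d Lc (j + 1) * ∑' v, ∑ l : Fin (d + 1), wΦ (N := Lc ^ (j + 1)) κ l (u - v) * m l v))
      = ∑' u, ∑ κ, (wVH d Lc (j + 1) * ∑' v, ∑ l : Fin (d + 1), wΦ (N := Lc ^ (j + 1)) κ l (u - v) * m l v)
          * (∑' x, ∑ κ₂, comp G (dM G Lc (SpureRecAt d Lc (toSite r) cE cVH cΛ (j + 1)) (M1At d Lc (toSite r) cΛ (j + 1)) ν y') u x (Sum.inl κ) (Sum.inl κ₂)
              * gaugeWt Lc y κ₂ x) := by
    rw [← Summable.tsum_finsetSum (fun κ _ => hsw κ)]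
    exact tsum_congr fun u => Finset.sum_congr rfl fun κ _ => mul_comm _ _
  rw [hL]
  simp only [gaugeWt_eq_dz]
  exact E2imageRead_comp_eq_sourceRead_succ hr j hWs hW hδ2 hmB hper (ψ := fun w : Site (d + 1) => if blk Lc w = y then (1 : ℝ) else 0) (Bψ := 1)
    (fun u => by split_ifs <;> simp)

/-! ## §3 (W-γ)_{j+1} modulo the pairing of the explicit source form -/

/-- NOT IN PRINT; OUR BOOKKEEPING.  **(W-γ)_{j+1}, EXIT⊗EXIT, MODULO THE SOURCE PAIRING OF THE EXPLICIT POTENTIAL ALONE** (in-block root, `α ≠ β`, all `cE cVH cΛ`, every `j`, slot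
`(ν,y′)`, label `y`, constant `c′`): `hP` = «for every real `c` with `C_{j+1} = wVH_{j+1}·Δ_{j+1}(c·Π^ρ m̃)`, the `n⋆ ⊗ gaugeWt` source pairing of `𝒟_{j+1}(e)` is
`c′·Σ'_u Σ_κ 𝟙[blk(u+e_κ) = y]·colH G_{j+1}(e) κ u·C_{j+1}(κ,u)`» ⟹ the (γ) exit⊗exit charge of the slot is `(−4c′)·V⁺_{j+1}` (`ExitChargeSourcePairing` §6 with the quantifier
over ALL representing potentials replaced by the ONE explicit family; `exists_explicit_potential_exitCharge` ⨾ §1 ⨾ §2 ⨾ `wardGamma_exit_of_gammaRead`). -/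
theorem wardGamma_exit_of_explicitSourcePairing (hr : r ∈ box (d + 1) Lc) (cE cVH cΛ : ℝ) {α β : Fin (d + 1)} (hαβ : α ≠ β) (j : ℕ)
    (ν : Fin (d + 1)) (y' y : Site (d + 1)) (c' : ℝ)
    (hP : ∀ c : ℝ, (∀ (ν : Fin (d + 1)) (y' : Site (d + 1)), ∑' xz : Site (d + 1) × Site (d + 1),
        (if xz.1 α % (Lc : ℤ) = (Lc : ℤ) - 1 then (1 : ℝ) else 0) * (if xz.2 β % (Lc : ℤ) = (Lc : ℤ) - 1 then (1 : ℝ) else 0)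
          * SpureRecAt d Lc (toSite r) cE cVH cΛ (j + 1) ν y' xz.1 xz.2 (Sum.inl α) (Sum.inl β)
        = wVH d Lc (j + 1) * ∑' v, ∑ l : Fin (d + 1), wΦ (N := Lc ^ (j + 1)) ν l (y' - v) * (c * axProjAt (toSite r) Lc
            (fun l x => (if l = α then ((Lc : ℝ) ^ 2)⁻¹ * (((x β % (Lc : ℤ) : ℤ)) : ℝ) else 0)
              - (if l = β then (Lc : ℝ)⁻¹ * (if x β % (Lc : ℤ) = (Lc : ℤ) - 1 then (1 : ℝ) else 0) * (((x α % (Lc : ℤ) : ℤ)) : ℝ) else 0)) l v)) →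
      ∑' x, ∑ κ₂, gaugeWt Lc y κ₂ x * (∑' u, ∑ κ,
          (axProjAt (toSite r) Lc
                  (fun l v => c * axProjAt (toSite r) Lc
                (fun l x => (if l = α then ((Lc : ℝ) ^ 2)⁻¹ * (((x β % (Lc : ℤ) : ℤ)) : ℝ) else 0)
              - (if l = β then (Lc : ℝ)⁻¹ * (if x β % (Lc : ℤ) = (Lc : ℤ) - 1 then (1 : ℝ) else 0) * (((x α % (Lc : ℤ) : ℤ)) : ℝ) else 0)) l v) κ u
                - ((Lc : ℝ) ^ (d + 1))⁻¹ * (contourSum Lc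
                  (fun l v => c * axProjAt (toSite r) Lc
                (fun l x => (if l = α then ((Lc : ℝ) ^ 2)⁻¹ * (((x β % (Lc : ℤ) : ℤ)) : ℝ) else 0)
              - (if l = β then (Lc : ℝ)⁻¹ * (if x β % (Lc : ℤ) = (Lc : ℤ) - 1 then (1 : ℝ) else 0) * (((x α % (Lc : ℤ) : ℤ)) : ℝ) else 0)) l v) κ 0
                  * (if u κ % (Lc : ℤ) = (Lc : ℤ) - 1 then (1 : ℝ) else 0)))
            * dM (coDressKBmAt (toSite r) Lc (KInvStep (d := d) Lc (j + 1))) Lc (SpureRecAt d Lc (toSite r) cE cVH cΛ (j + 1)) (M1At d Lc (toSite r) cΛ (j + 1)) ν y'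
                u x (Sum.inl κ) (Sum.inl κ₂))
        = c' * ∑' u : Site (d + 1), ∑ κ : Fin (d + 1), (if blk Lc (u + Pi.single κ 1) = y then (1 : ℝ) else 0)
            * colH (coDressKBmAt (toSite r) Lc (KInvStep (d := d) Lc (j + 1))) Lc ν y' κ u
            * ∑' xz : Site (d + 1) × Site (d + 1), ((if xz.1 α % (Lc : ℤ) = (Lc : ℤ) - 1 then (1 : ℝ) else 0) * (if xz.2 β % (Lc : ℤ) = (Lc : ℤ) - 1 then (1 : ℝ) else 0))
            * SpureRecAt d Lc (toSite r) cE cVH cΛ (j + 1) κ u xz.1 xz.2 (Sum.inl α) (Sum.inl β)) :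
    (∑ κ : Fin (d + 1), ∑' u : Site (d + 1),
        (∑' x, ∑ κ₂, comp (coDressKBmAt (toSite r) Lc (KInvStep (d := d) Lc (j + 1)))
            (dM (coDressKBmAt (toSite r) Lc (KInvStep (d := d) Lc (j + 1))) Lc (SpureRecAt d Lc (toSite r) cE cVH cΛ (j + 1)) (M1At d Lc (toSite r) cΛ (j + 1)) ν y')
            u x (Sum.inl κ) (Sum.inl κ₂) * gaugeWt Lc y κ₂ x)
          * ∑' xz : Site (d + 1) × Site (d + 1), ((if xz.1 α % (Lc : ℤ) = (Lc : ℤ) - 1 then (1 : ℝ) else 0) * (if xz.2 β % (Lc : ℤ) = (Lc : ℤ) - 1 then (1 : ℝ) else 0))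
            * SpureRecAt d Lc (toSite r) cE cVH cΛ (j + 1) κ u xz.1 xz.2 (Sum.inl α) (Sum.inl β))
      = (-4 * c') * ((1 / 2 : ℝ) *
        ((∑ κ : Fin (d + 1), ∑' u : Site (d + 1),
            colH (coDressKBmAt (toSite r) Lc (KInvStep (d := d) Lc (j + 1))) Lc ν y' κ u
              * ((if y' + Pi.single ν 1 = y then (1 / 2 : ℝ) else 0) - (if blk Lc (u + Pi.single κ 1) = y then (1 / 2 : ℝ) else 0))
              * ∑' xz : Site (d + 1) × Site (d + 1), ((if xz.1 α % (Lc : ℤ) = (Lc : ℤ) - 1 then (1 : ℝ) else 0) * (if xz.2 β % (Lc : ℤ) = (Lc : ℤ) - 1 then (1 : ℝ) else 0))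
            * SpureRecAt d Lc (toSite r) cE cVH cΛ (j + 1) κ u xz.1 xz.2 (Sum.inl α) (Sum.inl β))
          + ∑ ρ' : Fin (d + 1), ∑' w : Site (d + 1),
            colM (coDressKBmAt (toSite r) Lc (KInvStep (d := d) Lc (j + 1))) Lc ν y' ρ' w
              * ((if y' + Pi.single ν 1 = y then (1 / 2 : ℝ) else 0) - (if w + Pi.single ρ' 1 = y then (1 / 2 : ℝ) else 0))
              * ∑' xz : Site (d + 1) × Site (d + 1), ((if xz.1 α % (Lc : ℤ) = (Lc : ℤ) - 1 then (1 : ℝ) else 0) * (if xz.2 β % (Lc : ℤ) = (Lc : ℤ) - 1 then (1 : ℝ) else 0))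
            * M1At d Lc (toSite r) cΛ (j + 1) ρ' w xz.1 xz.2 (Sum.inl α) (Sum.inl β))) := by
  obtain ⟨c, hT⟩ := exists_explicit_potential_exitCharge hr cE cVH cΛ hαβ j
  have hγ := gaugeCharge_exit_eq_sourcePairing_of hr cE cVH cΛ j
    (m := (fun l v => c * axProjAt (toSite r) Lc
                (fun l x => (if l = α then ((Lc : ℝ) ^ 2)⁻¹ * (((x β % (Lc : ℤ) : ℤ)) : ℝ) else 0)
              - (if l = β then (Lc : ℝ)⁻¹ * (if x β % (Lc : ℤ) = (Lc : ℤ) - 1 then (1 : ℝ) else 0) * (((x α % (Lc : ℤ) : ℤ)) : ℝ) else 0)) l v))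
    (fun κ u => explicitPotential_abs_le hr hαβ c κ u) (fun κ x v => explicitPotential_add_zsmul hαβ c κ x v) hT ν y' y
  exact wardGamma_exit_of_gammaRead hr cE cVH cΛ hαβ j ν y' y (hγ.trans (hP c hT))

end Summit.QuantumFields.BalabanUV.Beta.GAN24.WardGammaExitExplicitPotential

end
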